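import Summits.BirchSwinnertonDyer.BirchSwinnertonDyer.Theorems.QuadraticBranchSignedControlPlusEtaNonsurjPlusCoeffCongruenceLambda
import Summits.BirchSwinnertonDyer.BirchSwinnertonDyer.Theorems.QuadraticBranchSignedControlPlusEtaNonsurjMinusCoeffCongruenceMazur
import Summits.BirchSwinnertonDyer.BirchSwinnertonDyer.Theorems.QuadraticBranchSignedControlPlusEtaNonsurjMinusCoeffCongruenceLambda
import HarnessLib

/-!
# Route `QuadraticBranchSignedControl` (rung K8, cell `bsd-potss`), residual crux `PlusEtaMainConjectureNonsurj`
# (stmt-BirchSwinnertonDyer-19606): THE μ⁺-CERTIFICATE IN ROW CURRENCY — v7's `stub_analyticEtaMu_cm` AT ONE ROW `V` from Mazur's `p ∤ c₀` and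
# ONE displayed pattern of `λ⁺ + 1` symbol valuations (seat `bsd-potss-k8eta-c2` g25; sequel of `…PlusCoeffCongruenceLambda.lean`)

WHY. v7's content stub `stub_analyticEtaMu_cm` reads, at a row `V` (globally minimal, good at `p ≥ 5`, `a_p(V) = 0`):
«`∀ f, IsNewformOf V f → ∀ ϖ, (period relation) → ∀ Lη, IsQuadraticBranchPlusLFunction f p ϖ Lη → HasUnitContent Lη`». The prequel's
`hasUnitContent_and_mu_lam_plus_of_padicNorm` gives this for ONE `f, ϖ, Lη` from `‖ϖ‖_p ≤ 1` and the displayed valuations; THIS FILE removes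
`‖ϖ‖_p ≤ 1` with Mazur's `hM` (the period ratio is unique, g24's `norm_periodRatio_le_one_of_mazur`) and `a_p(f) = a_p(V) = 0`, `p ∤ N` from
`IsNewformOf` — so a per-row μ⁺-record displays EXACTLY: the row's kernel data (minimality, good reduction, `a_p = 0`), the named fact `hM`, and
the valuations of `λ⁺ + 1` rationals `ϖ·coeff_jθ_{2m}(η)` (`j ≤ λ⁺ < p − 1`, one level `2m ≥ 2`; for `λ⁺ = 0` one rational at any level). The numerics
that SUPPORT the displayed pattern per row are the binomial moments `Σ_u C(u,j)·TH_{2m}[u]` of g23/g24's engine (k8eta-c2 g25 P-25, CM rows at `p = 5`).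

WHAT. §12 `hasUnitContent_and_mu_lam_plus_of_mazurTate_padicNorm` (row currency, conclusion `HasUnitContent ∧ μ = 0 ∧ lam = λ ∧ normLam = λ`),
`analyticEtaMu_row_of_mazurTate_padicNorm` (conclusion VERBATIM the stub's, `HasUnitContent Lη`), and the `λ⁺ = 0` forms
`…_of_mazurTate_padicNorm_zero` / `analyticEtaMu_row_of_mazurTate_padicNorm_zero`; §13 the CONVERSES `padicNorm_theta_plus_of_firstUnitCoeff` /
`padicNorm_theta_minus_of_firstUnitCoeff` and `padicNorm_theta_plus_iff_firstUnitCoeff`: the displayed pattern is EQUIVALENT to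
«`μ(L) = 0 ∧ λ(L) = λ`» (both signs) — so each row of the census TESTS PARI's `(λ, μ = 0)`: a row violating its pattern refutes that claim.

HONEST FRAMING (cell `bsd-potss`; FULL-BSD rank ≤ 1 programme, HUMAN RULING D-0036/D-0074): TOOL THEOREMS ONLY — no definition, no named fact
minted, no `sorry`, axioms standard; CONDITIONAL on the displayed named fact `hM` (Mazur); the symbol valuations stay DISPLAYED per-row hypotheses;
`stub_analyticEtaMu_cm` (a class-wide `∀ V`) is NOT proved; nothing about (A), (C1⁺_η), C-cc-1 or `BSD(W,p)` of any pair is claimed; crux and route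
OPEN; nothing booked. `--supports stmt-BirchSwinnertonDyer-19606`.

References: [Pollack2003] Prop. 6.18; [Kobayashi2003] Thm. 3.2, (3.4), (3.6) (p. 7); [Mazur1978] Cor. 4.1; [GreenbergVatsal2000] p. 2 (1)–(2); [Washington1997] §7.1.
-/

set_option autoImplicit false
set_option linter.dupNamespace false
noncomputable section

open scoped Classical MatrixGroups ModularForm

open CongruenceSubgroup Polynomial WeierstrassCurve Literature.NumberTheory.EllipticCurves
  Literature.NumberTheory.EllipticCurves.ModularForms
  Literature.NumberTheory.EllipticCurves.GreenbergVatsal2000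
  Literature.NumberTheory.EllipticCurves.Rank1Residual
open Summit.BirchSwinnertonDyer.Rank1Residual Summit.BirchSwinnertonDyer.Rank1Residual.Additive
open Summit.BirchSwinnertonDyer.BirchSwinnertonDyer.Theorems.EtaMinusCoeffCongruence

namespace Summit.BirchSwinnertonDyer.BirchSwinnertonDyer.Theorems.EtaPlusCoeffCongruence

/-! ## §12 Row currency: the μ⁺-certificate of a row `V` -/

section Rows

variable (p : ℕ) [hp : Fact p.Prime]

/-- **THE μ⁺-CERTIFICATE OF A ROW (`λ⁺ = λ < p − 1`, level `2m ≥ 2`).** `V` globally minimal, good at `p ≥ 5` with `a_p(V) = 0`; named fact `hM`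
(Mazur: `‖ϖ‖_p ≤ 1` for every period ratio); DISPLAYED: for the newform `f` of `V` and every period ratio `ϖ`, with `θ = quadraticBranchMazurTateElement p f (2m)`,
`‖ϖ·coeff_jθ‖_p ≤ p^{−(m+1)}` for `j < λ` and `‖ϖ·coeff_λθ‖_p = p^{−m}`. CONCLUSION: every plus branch function `Lη` of `f` has `HasUnitContent Lη`,
`μ(Lη) = 0`, `λ(Lη) = λ`. [cite: Pollack2003, Prop. 6.18] [cite: Kobayashi2003, Thm. 3.2, (3.4), (3.6) (p. 7)] [cite: Mazur1978, Cor. 4.1] -/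
theorem hasUnitContent_and_mu_lam_plus_of_mazurTate_padicNorm (hM : mazur_not_dvd_maninConstant_of_odd) (hp5 : 5 ≤ p)
    (V : WeierstrassCurve ℚ) [V.IsElliptic] [V.IsGloballyMinimal] (hgood : V.HasGoodReductionAtPrime p)
    (hap : V.frobeniusTrace p = 0) (m : ℕ) (hm : 1 ≤ m) (lam : ℕ) (hlam : lam < p - 1)
    (hθ : ∀ {N : ℕ} [NeZero N] {f : CuspForm (Gamma0 N) 2}, IsNewformOf V f →
      ∀ (ϖ : ℚ), (if Even (p / 2) then (ϖ : ℝ) * V.realPeriodRat = plusPeriod f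
          else (ϖ : ℝ) * V.imaginaryPeriodRat = minusPeriod f) →
        (∀ j < lam, ‖(ϖ : ℚ_[p]) * (((quadraticBranchMazurTateElement p f (2 * m)).coeff j : ℚ) : ℚ_[p])‖ ≤
            ((p : ℝ)⁻¹) ^ (m + 1)) ∧
          ‖(ϖ : ℚ_[p]) * (((quadraticBranchMazurTateElement p f (2 * m)).coeff lam : ℚ) : ℚ_[p])‖ = ((p : ℝ)⁻¹) ^ m) :
    ∀ {N : ℕ} [NeZero N] {f : CuspForm (Gamma0 N) 2}, IsNewformOf V f →
      ∀ (ϖ : ℚ), (if Even (p / 2) then (ϖ : ℝ) * V.realPeriodRat = plusPeriod f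
          else (ϖ : ℝ) * V.imaginaryPeriodRat = minusPeriod f) →
      ∀ (Lη : IwasawaAlgebra p), IsQuadraticBranchPlusLFunction f p ϖ Lη →
        HasUnitContent Lη ∧ X1.MuLambda.mu Lη = 0 ∧ X1.MuLambda.lam Lη = lam ∧ normLam Lη = lam := by
  intro N _ f hf ϖ hrel Lη hL
  have hp2 : p ≠ 2 := by omega
  have hϖ := norm_periodRatio_le_one_of_mazur p hM hp5 V f hf hgood hap ϖ hrel
  obtain ⟨hlow, htop⟩ := hθ hf ϖ hrel
  have hap' : cuspCoeff f p = ((0 : ℤ) : ℂ) := by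
    rw [cuspCoeff_eq_frobeniusTrace_of_isNewformOf_holds hf hgood, hap]
  exact hasUnitContent_and_mu_lam_plus_of_padicNorm hp2 hf.1 hf.coeffField_eq_bot (not_dvd_level_of_isNewformOf hf hgood)
    hap' hϖ hL m hm hlam hlow htop

/-- **v7's `stub_analyticEtaMu_cm` AT THE ROW `V`, from symbols** (`λ⁺ = λ < p − 1`, level `2m ≥ 2`): same data, conclusion VERBATIM the stub's inner
statement `∀ f ϖ Lη, IsNewformOf V f → (period relation) → IsQuadraticBranchPlusLFunction f p ϖ Lη → HasUnitContent Lη`.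
[cite: Pollack2003, Prop. 6.18] [cite: Kobayashi2003, Thm. 3.2, (3.4), (3.6) (p. 7)] [cite: Mazur1978, Cor. 4.1] [cite: GreenbergVatsal2000, p. 2, (2)] -/
theorem analyticEtaMu_row_of_mazurTate_padicNorm (hM : mazur_not_dvd_maninConstant_of_odd) (hp5 : 5 ≤ p)
    (V : WeierstrassCurve ℚ) [V.IsElliptic] [V.IsGloballyMinimal] (hgood : V.HasGoodReductionAtPrime p)
    (hap : V.frobeniusTrace p = 0) (m : ℕ) (hm : 1 ≤ m) (lam : ℕ) (hlam : lam < p - 1)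
    (hθ : ∀ {N : ℕ} [NeZero N] {f : CuspForm (Gamma0 N) 2}, IsNewformOf V f →
      ∀ (ϖ : ℚ), (if Even (p / 2) then (ϖ : ℝ) * V.realPeriodRat = plusPeriod f
          else (ϖ : ℝ) * V.imaginaryPeriodRat = minusPeriod f) →
        (∀ j < lam, ‖(ϖ : ℚ_[p]) * (((quadraticBranchMazurTateElement p f (2 * m)).coeff j : ℚ) : ℚ_[p])‖ ≤
            ((p : ℝ)⁻¹) ^ (m + 1)) ∧
          ‖(ϖ : ℚ_[p]) * (((quadraticBranchMazurTateElement p f (2 * m)).coeff lam : ℚ) : ℚ_[p])‖ = ((p : ℝ)⁻¹) ^ m) :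
    ∀ {N : ℕ} [NeZero N] {f : CuspForm (Gamma0 N) 2}, IsNewformOf V f →
      ∀ (ϖ : ℚ), (if Even (p / 2) then (ϖ : ℝ) * V.realPeriodRat = plusPeriod f
          else (ϖ : ℝ) * V.imaginaryPeriodRat = minusPeriod f) →
      ∀ (Lη : IwasawaAlgebra p), IsQuadraticBranchPlusLFunction f p ϖ Lη → HasUnitContent Lη :=
  fun hf ϖ hrel Lη hL ↦
    (hasUnitContent_and_mu_lam_plus_of_mazurTate_padicNorm p hM hp5 V hgood hap m hm lam hlam hθ hf ϖ hrel Lη hL).1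

/-- **THE μ⁺-CERTIFICATE OF A ROW at `λ⁺ = 0` (any level `m`).** DISPLAYED: `‖ϖ·θ_{2m}(η)(0)‖_p = p^{−m}` for the newform of `V` and every period
ratio (at `m = 0`: `‖ϖ·Σ_a η(a)[a/p]^δ_f‖_p = 1`, i.e. `p ∤ L(W,1)/Ω` up to the tree's units, Kobayashi (3.6)). CONCLUSION: every plus branch function of
`f` has `HasUnitContent`, `μ = λ = 0`. [cite: Kobayashi2003, (3.6) (p. 7)] [cite: Mazur1978, Cor. 4.1] [cite: GreenbergVatsal2000, p. 2, (1)–(2)] -/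
theorem hasUnitContent_and_mu_lam_plus_of_mazurTate_padicNorm_zero (hM : mazur_not_dvd_maninConstant_of_odd) (hp5 : 5 ≤ p)
    (V : WeierstrassCurve ℚ) [V.IsElliptic] [V.IsGloballyMinimal] (hgood : V.HasGoodReductionAtPrime p)
    (hap : V.frobeniusTrace p = 0) (m : ℕ)
    (hθ : ∀ {N : ℕ} [NeZero N] {f : CuspForm (Gamma0 N) 2}, IsNewformOf V f →
      ∀ (ϖ : ℚ), (if Even (p / 2) then (ϖ : ℝ) * V.realPeriodRat = plusPeriod f
          else (ϖ : ℝ) * V.imaginaryPeriodRat = minusPeriod f) →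
        ‖(ϖ : ℚ_[p]) * (((quadraticBranchMazurTateElement p f (2 * m)).coeff 0 : ℚ) : ℚ_[p])‖ = ((p : ℝ)⁻¹) ^ m) :
    ∀ {N : ℕ} [NeZero N] {f : CuspForm (Gamma0 N) 2}, IsNewformOf V f →
      ∀ (ϖ : ℚ), (if Even (p / 2) then (ϖ : ℝ) * V.realPeriodRat = plusPeriod f
          else (ϖ : ℝ) * V.imaginaryPeriodRat = minusPeriod f) →
      ∀ (Lη : IwasawaAlgebra p), IsQuadraticBranchPlusLFunction f p ϖ Lη →
        HasUnitContent Lη ∧ X1.MuLambda.mu Lη = 0 ∧ X1.MuLambda.lam Lη = 0 ∧ normLam Lη = 0 := by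
  intro N _ f hf ϖ hrel Lη hL
  have hp2 : p ≠ 2 := by omega
  have hϖ := norm_periodRatio_le_one_of_mazur p hM hp5 V f hf hgood hap ϖ hrel
  have hap' : cuspCoeff f p = ((0 : ℤ) : ℂ) := by
    rw [cuspCoeff_eq_frobeniusTrace_of_isNewformOf_holds hf hgood, hap]
  exact hasUnitContent_and_mu_lam_plus_of_padicNorm_zero hp2 hf.1 hf.coeffField_eq_bot
    (not_dvd_level_of_isNewformOf hf hgood) hap' hϖ hL m (hθ hf ϖ hrel)

/-- **v7's `stub_analyticEtaMu_cm` AT THE ROW `V`, `λ⁺ = 0` form**: conclusion VERBATIM the stub's inner statement. [cite: Kobayashi2003, (3.6) (p. 7)]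
[cite: Mazur1978, Cor. 4.1] [cite: GreenbergVatsal2000, p. 2, (2)] -/
theorem analyticEtaMu_row_of_mazurTate_padicNorm_zero (hM : mazur_not_dvd_maninConstant_of_odd) (hp5 : 5 ≤ p)
    (V : WeierstrassCurve ℚ) [V.IsElliptic] [V.IsGloballyMinimal] (hgood : V.HasGoodReductionAtPrime p)
    (hap : V.frobeniusTrace p = 0) (m : ℕ)
    (hθ : ∀ {N : ℕ} [NeZero N] {f : CuspForm (Gamma0 N) 2}, IsNewformOf V f →
      ∀ (ϖ : ℚ), (if Even (p / 2) then (ϖ : ℝ) * V.realPeriodRat = plusPeriod f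
          else (ϖ : ℝ) * V.imaginaryPeriodRat = minusPeriod f) →
        ‖(ϖ : ℚ_[p]) * (((quadraticBranchMazurTateElement p f (2 * m)).coeff 0 : ℚ) : ℚ_[p])‖ = ((p : ℝ)⁻¹) ^ m) :
    ∀ {N : ℕ} [NeZero N] {f : CuspForm (Gamma0 N) 2}, IsNewformOf V f →
      ∀ (ϖ : ℚ), (if Even (p / 2) then (ϖ : ℝ) * V.realPeriodRat = plusPeriod f
          else (ϖ : ℝ) * V.imaginaryPeriodRat = minusPeriod f) →
      ∀ (Lη : IwasawaAlgebra p), IsQuadraticBranchPlusLFunction f p ϖ Lη → HasUnitContent Lη :=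
  fun hf ϖ hrel Lη hL ↦
    (hasUnitContent_and_mu_lam_plus_of_mazurTate_padicNorm_zero p hM hp5 V hgood hap m hθ hf ϖ hrel Lη hL).1

end Rows

/-! ## §13 The converse readings (pure `Λ` side): the displayed pattern is EQUIVALENT to `μ = 0 ∧ λ = λ₀` (both signs) -/

section Converse

variable {p : ℕ} [hp : Fact p.Prime] {N : ℕ} [NeZero N] {f : CuspForm (Gamma0 N) 2}


/-- Over `ℤ_p`, a non-unit has norm `≤ p⁻¹`. [folklore] -/
theorem norm_le_inv_of_not_isUnit {x : ℤ_[p]} (hx : ¬ IsUnit x) : ‖x‖ ≤ (p : ℝ)⁻¹ := by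
  have hlt : ‖x‖ < 1 := lt_of_le_of_ne (PadicInt.norm_le_one x) fun h ↦ hx (PadicInt.isUnit_iff.mpr h)
  have h := (PadicInt.norm_le_pow_iff_norm_lt_pow_add_one x (-1)).mpr (by rwa [show (-1 : ℤ) + 1 = 0 by norm_num, zpow_zero])
  rwa [zpow_neg, zpow_one] at h

/-- **CONVERSE of the λ⁺-reading.** If a plus branch function `L` (`‖ϖ‖_p ≤ 1`) has `coeff_jL ∉ ℤ_pˣ` for `j < λ` and `coeff_λL ∈ ℤ_pˣ`
(`μ(L) = 0`, `λ(L) = λ`), `m ≥ 1`, `λ < p − 1`, then the symbols SHOW it: `‖ϖ·coeff_jθ_{2m}(η)‖ ≤ p^{−(m+1)}` for `j < λ` and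
`‖ϖ·coeff_λθ_{2m}(η)‖ = p^{−m}`. With `lambda_reading_plus_of_padicNorm` the displayed pattern is EQUIVALENT to PARI's claim «`μ⁺ = 0`, `λ⁺ = λ`»
(so a row violating the pattern REFUTES that claim). [cite: Pollack2003, Prop. 6.18] [cite: Washington1997, §7.1] -/
theorem padicNorm_theta_plus_of_firstUnitCoeff (hp2 : p ≠ 2) (hf0 : IsNewform0 f) (hQ : coeffField f = ⊥)
    (hpN : ¬ p ∣ N) (hap : cuspCoeff f p = ((0 : ℤ) : ℂ)) {ϖ : ℚ} (hϖ : ‖(ϖ : ℚ_[p])‖ ≤ 1)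
    {L : IwasawaAlgebra p} (hL : IsQuadraticBranchPlusLFunction f p ϖ L) (m : ℕ) (hm : 1 ≤ m) {lam : ℕ}
    (hlam : lam < p - 1) (hunit : (∀ j < lam, ¬ IsUnit (PowerSeries.coeff j L)) ∧ IsUnit (PowerSeries.coeff lam L)) :
    (∀ j < lam,
      ‖(ϖ : ℚ_[p]) * (((quadraticBranchMazurTateElement p f (2 * m)).coeff j : ℚ) : ℚ_[p])‖ ≤ ((p : ℝ)⁻¹) ^ (m + 1)) ∧
    ‖(ϖ : ℚ_[p]) * (((quadraticBranchMazurTateElement p f (2 * m)).coeff lam : ℚ) : ℚ_[p])‖ = ((p : ℝ)⁻¹) ^ m := by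
  have hP : p.Prime := hp.out
  have hp1 : (1 : ℝ) < p := by exact_mod_cast hP.one_lt
  have hp0 : (0 : ℝ) < p := by positivity
  obtain ⟨M, hM⟩ := exists_isCongrModOmega_quadraticBranch_even hp2 hf0 hQ hpN hap
  obtain ⟨v, hv⟩ := exists_units_forall_coeff_eq_plus hp2 hϖ hL hM
  have hnormL : ∀ j, ‖PowerSeries.coeff j L‖ = ‖(ϖ : ℚ_[p]) * ((PowerSeries.coeff j M : ℤ_[p]) : ℚ_[p])‖ := by
    intro j
    rw [PadicInt.norm_def, hv j, norm_mul, PadicInt.padic_norm_e_of_padicInt, PadicInt.norm_units, one_mul]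
  have hsmall : ∀ t < lam, ‖(ϖ : ℚ_[p]) * ((PowerSeries.coeff t M : ℤ_[p]) : ℚ_[p])‖ ≤ (p : ℝ)⁻¹ :=
    fun t ht ↦ (hnormL t) ▸ norm_le_inv_of_not_isUnit (hunit.1 t ht)
  have key : ∀ j ≤ lam, ‖(ϖ : ℚ_[p]) * (((quadraticBranchMazurTateElement p f (2 * m)).coeff j : ℚ) : ℚ_[p]) -
      (-1) ^ (m + 1) * (p : ℚ_[p]) ^ m * ((ϖ : ℚ_[p]) * ((PowerSeries.coeff j M : ℤ_[p]) : ℚ_[p]))‖ ≤ ((p : ℝ)⁻¹) ^ (m + 1) := by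
    intro j hj
    obtain ⟨r, hr⟩ := exists_coeff_mazurTate_plus_eq_sum hp2 hf0 hQ hpN hap m (show j < p by omega) (hM m)
    exact norm_sub_le_of_forall_norm_le_plus m hm (show j < p - 1 by omega) hr hϖ (fun t ht ↦ hsmall t (by omega))
  refine ⟨fun j hj ↦ ?_, ?_⟩
  · set a := (ϖ : ℚ_[p]) * (((quadraticBranchMazurTateElement p f (2 * m)).coeff j : ℚ) : ℚ_[p]) with ha
    set b := (-1 : ℚ_[p]) ^ (m + 1) * (p : ℚ_[p]) ^ m * ((ϖ : ℚ_[p]) * ((PowerSeries.coeff j M : ℤ_[p]) : ℚ_[p])) with hb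
    have hbn : ‖b‖ ≤ ((p : ℝ)⁻¹) ^ (m + 1) := by
      rw [hb, norm_mul, norm_mul, norm_pow, norm_neg, norm_one, one_pow, one_mul, norm_pow, Padic.norm_p, pow_succ]
      exact mul_le_mul_of_nonneg_left (hsmall j hj) (pow_nonneg (inv_nonneg.mpr hp0.le) m)
    have e : a = (a - b) + b := by ring
    rw [e]
    exact (IsUltrametricDist.norm_add_le_max _ _).trans (max_le (key j hj.le) hbn)
  · set a := (ϖ : ℚ_[p]) * (((quadraticBranchMazurTateElement p f (2 * m)).coeff lam : ℚ) : ℚ_[p]) with ha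
    set b := (-1 : ℚ_[p]) ^ (m + 1) * (p : ℚ_[p]) ^ m * ((ϖ : ℚ_[p]) * ((PowerSeries.coeff lam M : ℤ_[p]) : ℚ_[p])) with hb
    have hone : ‖(ϖ : ℚ_[p]) * ((PowerSeries.coeff lam M : ℤ_[p]) : ℚ_[p])‖ = 1 :=
      (hnormL lam) ▸ PadicInt.isUnit_iff.mp hunit.2
    have hbn : ‖b‖ = ((p : ℝ)⁻¹) ^ m := by
      rw [hb, norm_mul, norm_mul, norm_pow, norm_neg, norm_one, one_pow, one_mul, norm_pow, Padic.norm_p, hone, mul_one]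
    have hlt : ‖a - b‖ < ‖b‖ := by
      rw [hbn]
      refine (key lam le_rfl).trans_lt ?_
      rw [pow_succ]
      exact mul_lt_of_lt_one_right (pow_pos (inv_pos.mpr hp0) m) (inv_lt_one_of_one_lt₀ hp1)
    have e : a = (a - b) + b := by ring
    rw [e, Padic.add_eq_max_of_ne hlt.ne, max_eq_right hlt.le, hbn]

/-- **CONVERSE of the λ⁻-reading** (minus side, g24's `lambda_reading_of_padicNorm`): if a minus branch function `L` (`‖ϖ‖_p ≤ 1`) has
`coeff_jL ∉ ℤ_pˣ` for `j < λ` and `coeff_λL ∈ ℤ_pˣ`, `λ < p`, then `‖ϖ·coeff_jθ_{2m+1}(η)‖ ≤ p^{−(m+1)}` for `1 ≤ j < λ` and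
`‖ϖ·coeff_λθ_{2m+1}(η)‖ = p^{−m}` — the displayed pattern of the minus records is EQUIVALENT to «`μ⁻ = 0`, `λ⁻ = λ`» (for `λ ≥ 1`; `M⁻(0) = 0`).
[cite: Pollack2003, Prop. 6.18] [cite: Washington1997, §7.1] -/
theorem padicNorm_theta_minus_of_firstUnitCoeff (hp2 : p ≠ 2) (hf0 : IsNewform0 f) (hQ : coeffField f = ⊥)
    (hpN : ¬ p ∣ N) (hap : cuspCoeff f p = ((0 : ℤ) : ℂ)) {ϖ : ℚ} (hϖ : ‖(ϖ : ℚ_[p])‖ ≤ 1)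
    {L : IwasawaAlgebra p} (hL : IsQuadraticBranchMinusLFunction f p ϖ L) (m : ℕ) {lam : ℕ}
    (hlam : lam < p) (hunit : (∀ j < lam, ¬ IsUnit (PowerSeries.coeff j L)) ∧ IsUnit (PowerSeries.coeff lam L)) :
    (∀ j, 1 ≤ j → j < lam →
      ‖(ϖ : ℚ_[p]) * (((quadraticBranchMazurTateElement p f (2 * m + 1)).coeff j : ℚ) : ℚ_[p])‖ ≤ ((p : ℝ)⁻¹) ^ (m + 1)) ∧
    ‖(ϖ : ℚ_[p]) * (((quadraticBranchMazurTateElement p f (2 * m + 1)).coeff lam : ℚ) : ℚ_[p])‖ = ((p : ℝ)⁻¹) ^ m := by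
  have hP : p.Prime := hp.out
  have hp1 : (1 : ℝ) < p := by exact_mod_cast hP.one_lt
  have hp0 : (0 : ℝ) < p := by positivity
  obtain ⟨M, hM⟩ := exists_isCongrModOmega_quadraticBranch_odd hp2 hf0 hQ hpN hap
  obtain ⟨v, hv⟩ := exists_units_forall_coeff_eq hp2 hf0 hQ hpN hap hϖ hL hM
  have hnormL : ∀ j, ‖PowerSeries.coeff j L‖ = ‖(ϖ : ℚ_[p]) * ((PowerSeries.coeff j M : ℤ_[p]) : ℚ_[p])‖ := by
    intro j
    rw [PadicInt.norm_def, hv j, norm_mul, PadicInt.padic_norm_e_of_padicInt, PadicInt.norm_units, one_mul]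
  have hsmall : ∀ t < lam, ‖(ϖ : ℚ_[p]) * ((PowerSeries.coeff t M : ℤ_[p]) : ℚ_[p])‖ ≤ (p : ℝ)⁻¹ :=
    fun t ht ↦ (hnormL t) ▸ norm_le_inv_of_not_isUnit (hunit.1 t ht)
  have key : ∀ j ≤ lam, ‖(ϖ : ℚ_[p]) * (((quadraticBranchMazurTateElement p f (2 * m + 1)).coeff j : ℚ) : ℚ_[p]) -
      (-1) ^ (m + 1) * (p : ℚ_[p]) ^ m * ((ϖ : ℚ_[p]) * ((PowerSeries.coeff j M : ℤ_[p]) : ℚ_[p]))‖ ≤ ((p : ℝ)⁻¹) ^ (m + 1) := by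
    intro j hj
    obtain ⟨r, hr⟩ := exists_coeff_mazurTate_eq_sum hp2 hf0 hQ hpN hap m (show j < p by omega) (hM m)
    exact norm_sub_le_of_forall_norm_le m (show j < p by omega) hr hϖ (fun t ht ↦ hsmall t (by omega))
  refine ⟨fun j _ hj ↦ ?_, ?_⟩
  · set a := (ϖ : ℚ_[p]) * (((quadraticBranchMazurTateElement p f (2 * m + 1)).coeff j : ℚ) : ℚ_[p]) with ha
    set b := (-1 : ℚ_[p]) ^ (m + 1) * (p : ℚ_[p]) ^ m * ((ϖ : ℚ_[p]) * ((PowerSeries.coeff j M : ℤ_[p]) : ℚ_[p])) with hb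
    have hbn : ‖b‖ ≤ ((p : ℝ)⁻¹) ^ (m + 1) := by
      rw [hb, norm_mul, norm_mul, norm_pow, norm_neg, norm_one, one_pow, one_mul, norm_pow, Padic.norm_p, pow_succ]
      exact mul_le_mul_of_nonneg_left (hsmall j hj) (pow_nonneg (inv_nonneg.mpr hp0.le) m)
    have e : a = (a - b) + b := by ring
    rw [e]
    exact (IsUltrametricDist.norm_add_le_max _ _).trans (max_le (key j hj.le) hbn)
  · set a := (ϖ : ℚ_[p]) * (((quadraticBranchMazurTateElement p f (2 * m + 1)).coeff lam : ℚ) : ℚ_[p]) with ha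
    set b := (-1 : ℚ_[p]) ^ (m + 1) * (p : ℚ_[p]) ^ m * ((ϖ : ℚ_[p]) * ((PowerSeries.coeff lam M : ℤ_[p]) : ℚ_[p])) with hb
    have hone : ‖(ϖ : ℚ_[p]) * ((PowerSeries.coeff lam M : ℤ_[p]) : ℚ_[p])‖ = 1 :=
      (hnormL lam) ▸ PadicInt.isUnit_iff.mp hunit.2
    have hbn : ‖b‖ = ((p : ℝ)⁻¹) ^ m := by
      rw [hb, norm_mul, norm_mul, norm_pow, norm_neg, norm_one, one_pow, one_mul, norm_pow, Padic.norm_p, hone, mul_one]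
    have hlt : ‖a - b‖ < ‖b‖ := by
      rw [hbn]
      refine (key lam le_rfl).trans_lt ?_
      rw [pow_succ]
      exact mul_lt_of_lt_one_right (pow_pos (inv_pos.mpr hp0) m) (inv_lt_one_of_one_lt₀ hp1)
    have e : a = (a - b) + b := by ring
    rw [e, Padic.add_eq_max_of_ne hlt.ne, max_eq_right hlt.le, hbn]

/-- **THE EQUIVALENCE (plus side).** For a plus branch function `L`, `m ≥ 1`, `λ < p − 1`: the displayed symbol pattern at level `2m` holds iff
`coeff_jL ∉ ℤ_pˣ` (`j < λ`) and `coeff_λL ∈ ℤ_pˣ` — iff `μ(L) = 0 ∧ λ(L) = λ`. In particular the pattern at one level `2m ≥ 2` implies it at every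
other level `2m' ≥ 2`. [cite: Pollack2003, Prop. 6.18] [cite: Washington1997, §7.1] -/
theorem padicNorm_theta_plus_iff_firstUnitCoeff (hp2 : p ≠ 2) (hf0 : IsNewform0 f) (hQ : coeffField f = ⊥)
    (hpN : ¬ p ∣ N) (hap : cuspCoeff f p = ((0 : ℤ) : ℂ)) {ϖ : ℚ} (hϖ : ‖(ϖ : ℚ_[p])‖ ≤ 1)
    {L : IwasawaAlgebra p} (hL : IsQuadraticBranchPlusLFunction f p ϖ L) (m : ℕ) (hm : 1 ≤ m) {lam : ℕ}
    (hlam : lam < p - 1) :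
    ((∀ j < lam,
      ‖(ϖ : ℚ_[p]) * (((quadraticBranchMazurTateElement p f (2 * m)).coeff j : ℚ) : ℚ_[p])‖ ≤ ((p : ℝ)⁻¹) ^ (m + 1)) ∧
      ‖(ϖ : ℚ_[p]) * (((quadraticBranchMazurTateElement p f (2 * m)).coeff lam : ℚ) : ℚ_[p])‖ = ((p : ℝ)⁻¹) ^ m) ↔
    ((∀ j < lam, ¬ IsUnit (PowerSeries.coeff j L)) ∧ IsUnit (PowerSeries.coeff lam L)) :=
  ⟨fun h ↦ lambda_reading_plus_of_padicNorm hp2 hf0 hQ hpN hap hϖ hL m hm hlam h.1 h.2,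
    fun h ↦ padicNorm_theta_plus_of_firstUnitCoeff hp2 hf0 hQ hpN hap hϖ hL m hm hlam h⟩

end Converse

end Summit.BirchSwinnertonDyer.BirchSwinnertonDyer.Theorems.EtaPlusCoeffCongruence

end
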